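import Summits.AnomalousDissipation.AnomalousDissipation.Theorems.LaminarNeverLoud.Negative.Isolation

/-!
# Negative knowledge for the crux `LaminarNeverLoud` (stmt-AnomalousDissipation-2988): VI, uniqueness at large viscosity; isolation-only principle

Certified copy of §5 (uniqueness part) of the cdisprove work file `Cruxes/LaminarNeverLoud/Disproof.lean`.  Supports
stmt-AnomalousDissipation-2988.  UNIQUENESS OF STEADY GALERKIN STATES AT LARGE VISCOSITY at fixed resolution
(`steady_unique_of_large_viscosity`, every dimension: on a symmetric `S ∌ 0` two zeros of the Galerkin field at the
same `ν > 0` coincide once `2·convConst S·‖ĝ‖₂ < (4π²ν)²` — Temam 1979 Ch. II Thm. 1.3 at the Galerkin level with the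
tree's crude sup-norm bound of the convection symbol), whence `mem_stokesArc_of_large_viscosity` and the
ISOLATION-ONLY form of the isolation principle `admissible_of_isolated'`: if at every resolution `N ≥ |m|` the Stokes
arc of the shear force `2a cos(2π m x₁)e₀` is isolated in `V_N`, the crux's conclusion holds for that force with
`ν₀² = a²/(8π⁴m⁴E)`.  New def: the constant `convConst S`.
-/

noncomputable section

namespace Summit.AnomalousDissipation.AnomalousDissipation.Theorems.LaminarNeverLoud.Negative

open MeasureTheory Set Filter Topology UnitAddTorus
open scoped InnerProductSpace
open Literature.Analysis.FluidPDE Literature.Analysis.FluidPDE.Torus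
open Literature.Analysis.FunctionSpaces Literature.Analysis.FunctionSpaces.Torus
-- (migrate 2026-08-19) former `open …Theses.MirrorVariety (LaminarNeverLoud)` removed: the crux (item 2988, dropped at
-- rev 14) is the verbatim `@[conjecture] def Negative.LaminarNeverLoud` of `PowerBudget.lean`; no statement changed.

variable {d : Type*} [Fintype d] [DecidableEq d]

section Uniqueness

/-- The crude convection constant of a frequency set: `2π · #S · ∑_{m∈S} ∑ⱼ |mⱼ|`
(from the tree's `norm_convectionCoeff_le`). [folklore] -/
def convConst (S : Finset (d → ℤ)) : ℝ := 2 * Real.pi * (S.card * ∑ m ∈ S, ∑ j, |((m j : ℤ) : ℝ)|)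

omit [DecidableEq d] in
/-- The convection constant is nonnegative. [folklore] -/
theorem convConst_nonneg (S : Finset (d → ℤ)) : 0 ≤ convConst S := by
  unfold convConst; positivity

/-- **UNIQUENESS OF STEADY GALERKIN STATES AT LARGE VISCOSITY (fixed resolution)**: on a symmetric
`S ∌ 0`, two zeros of the Galerkin field at the same `ν > 0` coincide as soon as
`2 · convConst S · ‖g‖₂ < (4π²ν)²` (Temam 1979 Ch. II Thm. 1.3 at the Galerkin level, with the crude
sup-norm bound of the convection symbol; the threshold depends on `S`). [cite: Temam1979, Ch. II Thm. 1.3] -/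
theorem steady_unique_of_large_viscosity {S : Finset (d → ℤ)} (hS : ∀ k ∈ S, -k ∈ S)
    (hS0 : (0 : d → ℤ) ∉ S) {ν : ℝ} (hν : 0 < ν) {g c c' : ↥S → EuclideanSpace ℂ d}
    (hg : IsRealCoeff g) (hc : c ∈ galerkinSubspace S) (hc' : c' ∈ galerkinSubspace S)
    (h0 : galerkinRHS S ν g c = 0) (h0' : galerkinRHS S ν g c' = 0)
    (hlarge : 2 * convConst S * Real.sqrt (energy g) < (4 * Real.pi ^ 2 * ν) ^ 2) : c = c' := by
  by_contra hne
  have hw : c - c' ≠ 0 := sub_ne_zero.2 hne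
  obtain ⟨k₁, hk₁⟩ := Function.ne_iff.1 hw
  haveI : Nonempty ↥S := ⟨k₁⟩
  -- the sup norm of `w = c - c'` is attained at some `k₀`
  obtain ⟨k₀, -, hk₀⟩ := Finset.exists_mem_eq_sup (Finset.univ : Finset ↥S) Finset.univ_nonempty
    (fun k => ‖(c - c') k‖₊)
  have hwn : ‖c - c'‖ = ‖(c - c') k₀‖ := by
    rw [← coe_nnnorm, ← coe_nnnorm, Pi.nnnorm_def, hk₀]
  have hwpos : 0 < ‖c - c'‖ := norm_pos_iff.2 hw
  -- a priori sup-norm bounds `4π²ν‖c‖ ≤ √(energy g)` (and for `c'`)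
  have hapriori : ∀ {e : ↥S → EuclideanSpace ℂ d}, e ∈ galerkinSubspace S → galerkinRHS S ν g e = 0 →
      4 * Real.pi ^ 2 * ν * ‖e‖ ≤ Real.sqrt (energy g) := by
    intro e he h0e
    have h1 := sum_freqNormSq_mul_norm_sq_le_of_galerkinRHS_eq_zero hν hS hS0 hg he h0e
    have h2 : ‖e‖ ^ 2 ≤ ∑ k : ↥S, freqNormSq (k : d → ℤ) * ‖e k‖ ^ 2 :=
      (norm_sq_le_sum_norm_sq e).trans (sum_norm_sq_le_sum_freqNormSq_mul hS0 e)
    refine Real.le_sqrt_of_sq_le ?_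
    calc (4 * Real.pi ^ 2 * ν * ‖e‖) ^ 2 = (4 * Real.pi ^ 2 * ν) ^ 2 * ‖e‖ ^ 2 := by ring
      _ ≤ (4 * Real.pi ^ 2 * ν) ^ 2 * ∑ k : ↥S, freqNormSq (k : d → ℤ) * ‖e k‖ ^ 2 :=
          mul_le_mul_of_nonneg_left h2 (sq_nonneg _)
      _ ≤ energy g := h1
  have hcb := hapriori hc h0
  have hcb' := hapriori hc' h0'
  -- the equation for the difference at `k₀`
  have e1 := congrFun h0 k₀
  have e2 := congrFun h0' k₀
  rw [galerkinRHS_apply, galerkinField_def, Pi.zero_apply, neg_add_eq_zero] at e1 e2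
  set r : ℝ := ν * (4 * Real.pi ^ 2 * freqNormSq ((k₀ : ↥S) : d → ℤ)) with hr
  have hr0 : ν * (4 * Real.pi ^ 2) ≤ r := by
    have hk0 : ((k₀ : ↥S) : d → ℤ) ≠ 0 := fun h => hS0 (h ▸ k₀.2)
    have h1 : (1 : ℝ) ≤ freqNormSq ((k₀ : ↥S) : d → ℤ) := by
      obtain ⟨i, hi⟩ : ∃ i, ((k₀ : ↥S) : d → ℤ) i ≠ 0 := Function.ne_iff.1 hk0
      have hi1 : (1 : ℝ) ≤ ((((k₀ : ↥S) : d → ℤ) i : ℤ) : ℝ) ^ 2 := by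
        have h' : (1 : ℤ) ≤ (((k₀ : ↥S) : d → ℤ) i) ^ 2 := by
          have := Int.one_le_abs hi
          nlinarith [sq_abs (((k₀ : ↥S) : d → ℤ) i)]
        exact_mod_cast h'
      exact hi1.trans (Finset.single_le_sum (f := fun j => ((((k₀ : ↥S) : d → ℤ) j : ℤ) : ℝ) ^ 2)
        (fun j _ => sq_nonneg _) (Finset.mem_univ i))
    rw [hr]; nlinarith [Real.pi_pos, mul_pos hν (by positivity : (0:ℝ) < 4 * Real.pi ^ 2)]
  have hrpos : 0 < r := lt_of_lt_of_le (by positivity) hr0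
  set B := convectionCoeff S (coeffExt S c) (coeffExt S c) ((k₀ : ↥S) : d → ℤ) with hB
  set B' := convectionCoeff S (coeffExt S c') (coeffExt S c') ((k₀ : ↥S) : d → ℤ) with hB'
  have key : ((r : ℝ) : ℂ) • (c - c') k₀ = leraySym ((k₀ : ↥S) : d → ℤ) (B' - B) := by
    have h3 : ((r : ℝ) : ℂ) • coeffExt S c k₀ - ((r : ℝ) : ℂ) • coeffExt S c' k₀ =
        leraySym ((k₀ : ↥S) : d → ℤ) (coeffExt S g k₀ - B) - leraySym ((k₀ : ↥S) : d → ℤ) (coeffExt S g k₀ - B') := by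
      rw [e1, e2]
    rw [← leraySym_sub, sub_sub_sub_cancel_left, ← smul_sub, coeffExt_coe, coeffExt_coe] at h3
    rw [← h3]; rfl
  -- norms: `r ‖w‖ ≤ ‖B - B'‖ ≤ K ‖w‖ (‖c‖ + ‖c'‖)`
  have hnorm : r * ‖c - c'‖ ≤ convConst S * ‖c - c'‖ * (‖c‖ + ‖c'‖) := by
    have h1 : ‖((r : ℝ) : ℂ) • (c - c') k₀‖ = r * ‖c - c'‖ := by
      rw [norm_smul, Complex.norm_real, Real.norm_of_nonneg hrpos.le, hwn]
    have h2 : ‖leraySym ((k₀ : ↥S) : d → ℤ) (B' - B)‖ ≤ ‖B - B'‖ :=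
      (norm_leraySym_le _ _).trans (by rw [norm_sub_rev])
    have h3 : B - B' = convectionCoeff S (coeffExt S c - coeffExt S c') (coeffExt S c) ((k₀ : ↥S) : d → ℤ) +
        convectionCoeff S (coeffExt S c') (coeffExt S c - coeffExt S c') ((k₀ : ↥S) : d → ℤ) :=
      convectionCoeff_self_sub_self S _ _ _
    have hwb : ∀ l ∈ S, ‖(coeffExt S c - coeffExt S c') l‖ ≤ ‖c - c'‖ := fun l _ => by
      rw [← coeffExt_sub]; exact norm_coeffExt_le _ l
    have hcb1 : ∀ l ∈ S, ‖coeffExt S c l‖ ≤ ‖c‖ := fun l _ => norm_coeffExt_le _ l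
    have hcb2 : ∀ l ∈ S, ‖coeffExt S c' l‖ ≤ ‖c'‖ := fun l _ => norm_coeffExt_le _ l
    have h4 := norm_convectionCoeff_le S hwb hcb1 ((k₀ : ↥S) : d → ℤ)
    have h5 := norm_convectionCoeff_le S hcb2 hwb ((k₀ : ↥S) : d → ℤ)
    have h6 : ‖B - B'‖ ≤ convConst S * ‖c - c'‖ * ‖c‖ + convConst S * ‖c'‖ * ‖c - c'‖ := by
      rw [h3]; unfold convConst
      exact (norm_add_le _ _).trans (add_le_add h4 h5)
    calc r * ‖c - c'‖ = ‖((r : ℝ) : ℂ) • (c - c') k₀‖ := h1.symm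
      _ = ‖leraySym ((k₀ : ↥S) : d → ℤ) (B' - B)‖ := by rw [key]
      _ ≤ ‖B - B'‖ := h2
      _ ≤ _ := h6
      _ = convConst S * ‖c - c'‖ * (‖c‖ + ‖c'‖) := by ring
  -- divide by `‖w‖ > 0`, multiply by `4π²ν`, use the a priori bounds
  have h7 : r ≤ convConst S * (‖c‖ + ‖c'‖) := by
    have := hnorm; nlinarith [convConst_nonneg S, norm_nonneg c, norm_nonneg c']
  have h8 : (4 * Real.pi ^ 2 * ν) ^ 2 ≤ 2 * convConst S * Real.sqrt (energy g) := by
    calc (4 * Real.pi ^ 2 * ν) ^ 2 = (4 * Real.pi ^ 2 * ν) * (ν * (4 * Real.pi ^ 2)) := by ring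
      _ ≤ (4 * Real.pi ^ 2 * ν) * r := mul_le_mul_of_nonneg_left hr0 (by positivity)
      _ ≤ (4 * Real.pi ^ 2 * ν) * (convConst S * (‖c‖ + ‖c'‖)) := mul_le_mul_of_nonneg_left h7 (by positivity)
      _ = convConst S * (4 * Real.pi ^ 2 * ν * ‖c‖ + 4 * Real.pi ^ 2 * ν * ‖c'‖) := by ring
      _ ≤ convConst S * (Real.sqrt (energy g) + Real.sqrt (energy g)) :=
          mul_le_mul_of_nonneg_left (add_le_add hcb hcb') (convConst_nonneg S)
      _ = 2 * convConst S * Real.sqrt (energy g) := by ring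
  linarith

variable {S : Finset (Fin 3 → ℤ)} {m : ℤ}

/-- Consequently, for the shear force, beyond the resolution-dependent threshold every steady state lies on
the Stokes arc (hypothesis (ii) of the isolation principle, discharged). [folklore] -/
theorem mem_stokesArc_of_large_viscosity (hp : kol m ∈ S) (hn : -kol m ∈ S) (hS : ∀ k ∈ S, -k ∈ S)
    (hS0 : (0 : Fin 3 → ℤ) ∉ S) (hm : m ≠ 0) (a : ℝ) {z : (↥S → EuclideanSpace ℂ (Fin 3)) × ℝ}
    (hz : z ∈ steadySet S (shearVec S m a)) (hν : 0 < z.2)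
    (hlarge : 2 * convConst S * Real.sqrt (2 * a ^ 2) < (4 * Real.pi ^ 2 * z.2) ^ 2) :
    z ∈ stokesArc S m a := by
  have hg : IsRealCoeff (shearVec S m a) := (shearVec_mem m a).1
  have hsp := stokesPoint_mem hp hn hm a hν.ne'
  rw [← energy_shearVec hp hn hm a] at hlarge
  have heq := steady_unique_of_large_viscosity hS hS0 hν hg hz.1 hsp.1 hz.2
    (by simpa only [stokesPoint_snd] using hsp.2) hlarge
  refine ⟨z.2, hν, ?_⟩
  exact Prod.ext heq.symm rfl

/-- **THE ISOLATION PRINCIPLE, isolation-only form**: if at every resolution `N ≥ |m|` the Stokes arc of the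
shear force `2a cos(2π m x₁)e₀` (`m ≠ 0`, `a ≠ 0`) is isolated in `V_N`, then for all `E`, `ε > 0` the threshold
with `ν₀² = a²/(8π⁴m⁴E)` is admissible: the crux HOLDS for every such non-bifurcating force. [folklore] -/
theorem admissible_of_isolated' (hm : m ≠ 0) {a : ℝ} (ha : a ≠ 0)
    (hiso : ∀ N : ℕ, m.natAbs ≤ N → ∃ U : Set ((↥(modes (Fin 3) N) → EuclideanSpace ℂ (Fin 3)) × ℝ),
      IsOpen U ∧ stokesArc (modes (Fin 3) N) m a ⊆ U ∧
        U ∩ steadySet (modes (Fin 3) N) (shearVec (modes (Fin 3) N) m a) ⊆ stokesArc (modes (Fin 3) N) m a)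
    {E ε : ℝ} (hE : 0 < E) (hε : 0 < ε) :
    ∃ ν₀ ∈ admissibleSet (shearForce m a) E ε, 0 < ν₀ ∧ ν₀ ^ 2 = a ^ 2 / (8 * Real.pi ^ 4 * (m : ℝ) ^ 4 * E) := by
  refine admissible_of_isolated hm ha hiso (fun N hN => ?_) hE hε
  have hp : kol m ∈ modes (Fin 3) N := kol_mem_modes hm hN
  have hn : -kol m ∈ modes (Fin 3) N := neg_kol_mem_modes hm hN
  -- threshold: `(4π²ν₁)² ≥ 2 K √(2a²) + 1`
  set K : ℝ := convConst (modes (Fin 3) N) with hK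
  have hK0 : 0 ≤ K := convConst_nonneg _
  set T : ℝ := 2 * K * Real.sqrt (2 * a ^ 2) with hT
  have hT0 : 0 ≤ T := by positivity
  refine ⟨Real.sqrt (T + 1) / (4 * Real.pi ^ 2), fun z hz hzν => ?_⟩
  have hpos : 0 < z.2 := lt_of_le_of_lt (by positivity) hzν
  refine mem_stokesArc_of_large_viscosity hp hn (modes_symm N) (zero_not_mem_modes N) hm a hz hpos ?_
  have h1 : Real.sqrt (T + 1) < 4 * Real.pi ^ 2 * z.2 := by
    rw [div_lt_iff₀ (by positivity)] at hzν; linarith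
  have h2 : T + 1 < (4 * Real.pi ^ 2 * z.2) ^ 2 := by
    have h3 := Real.sq_sqrt (by positivity : 0 ≤ T + 1)
    nlinarith [Real.sqrt_nonneg (T + 1)]
  rw [← hK]; linarith

end Uniqueness

end Summit.AnomalousDissipation.AnomalousDissipation.Theorems.LaminarNeverLoud.Negative
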